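import Summits.NavierStokesRegularity.NavierStokesRegularity.Theorems.ExtremiserTransienceNearExtremalTransienceExtremiserLiouvilleConstantSpeedEnergyFluxLiouville
import Summits.NavierStokesRegularity.NavierStokesRegularity.Theorems.ExtremiserTransienceNearExtremalTransienceExtremiserLiouvilleConstantSpeedL2LiouvilleGeneral
import Summits.NavierStokesRegularity.NavierStokesRegularity.Theorems.ExtremiserTransienceNearExtremalTransienceExtremiserLiouvilleConstantSpeedResidue
import HarnessLib

/-!
# Crux `ExtremiserTransience.NearExtremalTransience` (stmt-NavierStokesRegularity-21883), line `extremiser_liouville`,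
# stub K1b — THE JET THEOREM (general far-field direction) and the reduction «K1b ⟸ no flat slab, no bi-infinite jet»

`--supports stmt-NavierStokesRegularity-21883` (helper).  Author: prover seat `ns-el-k1b` (g5).  The axial theorems of
`…ConstantSpeedEnergyFlux{,Invariance,Liouville}` conjugated by the reflection `R` with `R c = ‖c‖e₂`
(`exists_isometry_to_axis`: `⟪R⁻¹y, c⟫ = ‖c‖y₂`, `dist(R⁻¹y, ℝc) = cylRadius y`; measure preservation), as in g3/g4's
`…General` files.  With the axial coordinate `ξ(x) = ⟪x,c⟫/‖c‖` and the window energies along the far field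
`E(s) = ∫ H′(ξ(x) − s)‖w x − c‖² dx` (`H = Real.smoothTransition`):

* `integral_deriv_smoothTransition_axialCoord_mul_sq_eq` : **ENERGY-FLUX INVARIANCE** `E(s) = E(t)` (slab `{|ξ| ≤ T}`
  square integrable, `|s|+1, |t|+1 ≤ T`) for every `C¹` divergence-free `w` with `‖w‖ ≡ ‖c‖`, `c ≠ 0`;
* `eq_farField_of_constSpeed_of_smallWindow` : **VANISHING-WINDOW LIOUVILLE** (all slabs square integrable,
  `inf_s E(s) = 0` ⇒ `w ≡ c`);
* `eq_farField_of_constSpeed_of_horizontalDecay` : **HORIZONTAL-DECAY LIOUVILLE** (`w → c`,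
  `‖w x − c‖ ≤ C₀(1 + dist(x, ℝc))^{-a}`, `a > 1` ⇒ `w ≡ c`) — strictly contains g4's decay-gap Liouville;
* `stub_noAnalyticExtremal_of_noJetObject` : **K1b (verbatim) ⟸** «no constant-speed analytic extended extremiser with far
  field `c` is FLAT (a slab `{|ξ| ≤ T}` with `∫‖w − c‖² = ∞`) or a JET (all slabs square integrable and `E(s) ≡ E₀ > 0`)».
  Since the energy-flux invariance FORCES one of the two for any non-trivial residue object, this is the typed K1b target
  after g5: exclude the flat slab and the bi-infinite jet (the latter: the excess energy `E₀` — equivalently the volume flux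
  `E₀/(2‖c‖)` of `w − c` against the far field — crosses EVERY plane orthogonal to `c`, on both sides of the core, through
  cross-sections that must spread since `w → c`).

WHAT THIS IS NOT: K1b is NOT proved; nothing here proves NS regularity. [folklore]
-/

noncomputable section

open Set Filter Topology MeasureTheory Metric Function
open scoped ENNReal NNReal Topology InnerProductSpace RealInnerProductSpace ContDiff
open Literature.Analysis.FluidPDE Literature.Analysis

namespace Summit.NavierStokesRegularity.NavierStokesRegularity.Theorems

-- the problem directory repeats the summit name (`NavierStokesRegularity/NavierStokesRegularity`)
set_option linter.dupNamespace false

namespace ExtremiserLiouville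

/-! ## The reflection to the axial frame -/

/-- For `c ≠ 0` there is a linear isometry `R` with `R c = ‖c‖ e₂` (so `⟪R⁻¹y, c⟫ = ‖c‖ y₂` and the distance of `R⁻¹ y` to the
axis `ℝc` is `cylRadius y`). [folklore] -/
theorem exists_isometry_to_axis {c : EuclideanSpace ℝ (Fin 3)} (hc : c ≠ 0) :
    ∃ R : EuclideanSpace ℝ (Fin 3) ≃ₗᵢ[ℝ] EuclideanSpace ℝ (Fin 3),
      R c = ‖c‖ • EuclideanSpace.single (2 : Fin 3) (1 : ℝ) ∧
      (∀ y, ⟪R.symm y, c⟫ = ‖c‖ * y 2) ∧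
      ∀ y, ‖R.symm y - (⟪R.symm y, c⟫ / ‖c‖ ^ 2) • c‖ = cylRadius y := by
  set e : EuclideanSpace ℝ (Fin 3) := ‖c‖ • EuclideanSpace.single (2 : Fin 3) (1 : ℝ) with he
  have hce : ‖c‖ = ‖e‖ := by
    rw [he, norm_smul, Real.norm_eq_abs, abs_of_nonneg (norm_nonneg _), PiLp.norm_single, norm_one, mul_one]
  set R : EuclideanSpace ℝ (Fin 3) ≃ₗᵢ[ℝ] EuclideanSpace ℝ (Fin 3) := Submodule.reflection (ℝ ∙ (c - e))ᗮ with hR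
  have hRc : R c = e := Submodule.reflection_sub hce
  have hinner : ∀ y, ⟪R.symm y, c⟫ = ‖c‖ * y 2 := fun y => by
    rw [← R.inner_map_map (R.symm y) c, LinearIsometryEquiv.apply_symm_apply, hRc, he, inner_smul_right,
      EuclideanSpace.inner_single_right]
    simp
  have hcn : ‖c‖ ≠ 0 := norm_ne_zero_iff.2 hc
  refine ⟨R, hRc, hinner, fun y => ?_⟩
  have hRe3 : R.symm (EuclideanSpace.single (2 : Fin 3) (1 : ℝ)) = (‖c‖)⁻¹ • c := by
    have h : ‖c‖ • R.symm (EuclideanSpace.single (2 : Fin 3) (1 : ℝ)) = c := by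
      rw [← LinearIsometryEquiv.map_smul, ← he, ← hRc, LinearIsometryEquiv.symm_apply_apply]
    calc R.symm (EuclideanSpace.single (2 : Fin 3) (1 : ℝ))
        = (‖c‖)⁻¹ • (‖c‖ • R.symm (EuclideanSpace.single (2 : Fin 3) (1 : ℝ))) := by
          rw [smul_smul, inv_mul_cancel₀ hcn, one_smul]
      _ = (‖c‖)⁻¹ • c := by rw [h]
  have h1 : R.symm y - (⟪R.symm y, c⟫ / ‖c‖ ^ 2) • c = R.symm (y - (y 2) • EuclideanSpace.single (2 : Fin 3) (1 : ℝ)) := by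
    rw [map_sub, LinearIsometryEquiv.map_smul, hRe3, hinner, smul_smul]
    have hcoef : ‖c‖ * y 2 / ‖c‖ ^ 2 = y 2 * (‖c‖)⁻¹ := by
      field_simp
    rw [hcoef]
  rw [h1, R.symm.norm_map, cylRadius_eq_norm_sub_smul]

/-! ## General far-field direction -/

variable {w : EuclideanSpace ℝ (Fin 3) → EuclideanSpace ℝ (Fin 3)} {c : EuclideanSpace ℝ (Fin 3)} {M : ℝ}

/-- **Energy-flux invariance, general direction.**  For a `C¹` divergence-free field with `‖w‖ ≡ M = ‖c‖`, `c ≠ 0`, and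
`‖w − c‖² ∈ L¹` of the slab `{|⟪x, c⟫| ≤ T‖c‖}`: the window energies along the far-field axis
`E(s) = ∫ H′(⟪x,c⟫/‖c‖ − s) ‖w x − c‖² dx` satisfy `E(s) = E(t)` for `|s| + 1, |t| + 1 ≤ T`. [folklore] -/
theorem integral_deriv_smoothTransition_axialCoord_mul_sq_eq (hw : ContDiff ℝ 1 w) (hdiv : VectorCalculus.IsDivFree w)
    (hM : ∀ x, ‖w x‖ = M) (hcM : ‖c‖ = M) (hc : c ≠ 0) {T s t : ℝ} (hs : |s| + 1 ≤ T) (ht : |t| + 1 ≤ T)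
    (hL2 : Integrable (fun x => {x : EuclideanSpace ℝ (Fin 3) | |⟪x, c⟫| / ‖c‖ ≤ T}.indicator (fun x => ‖w x - c‖ ^ 2) x) volume) :
    (∫ x, deriv Real.smoothTransition (⟪x, c⟫ / ‖c‖ - s) * ‖w x - c‖ ^ 2) =
      ∫ x, deriv Real.smoothTransition (⟪x, c⟫ / ‖c‖ - t) * ‖w x - c‖ ^ 2 := by
  obtain ⟨R, hRc, hinner, -⟩ := exists_isometry_to_axis hc
  set e : EuclideanSpace ℝ (Fin 3) := ‖c‖ • EuclideanSpace.single (2 : Fin 3) (1 : ℝ) with he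
  have hcn : ‖c‖ ≠ 0 := norm_ne_zero_iff.2 hc
  set w' : EuclideanSpace ℝ (Fin 3) → EuclideanSpace ℝ (Fin 3) := fun y => R (w (R.symm y)) with hw'
  have hw'1 : ContDiff ℝ 1 w' := R.toContinuousLinearEquiv.contDiff.comp (hw.comp R.symm.toContinuousLinearEquiv.contDiff)
  have hdiv' : VectorCalculus.IsDivFree w' := hdiv.conj_linearIsometryEquiv R
  set V : EuclideanSpace ℝ (Fin 3) → EuclideanSpace ℝ (Fin 3) := fun y => w' y - e with hVdef
  have hV : ContDiff ℝ 1 V := hw'1.sub contDiff_const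
  have hVdiv : VectorCalculus.IsDivFree V := isDivFree_sub_const hdiv' e
  have heM : ‖e‖ = M := by
    rw [he, norm_smul, Real.norm_eq_abs, abs_of_nonneg (norm_nonneg _), PiLp.norm_single, norm_one, mul_one, hcM]
  have hVc : ∀ y, ⟪V y, e⟫ = -(‖V y‖ ^ 2 / 2) := fun y => by
    have h : ‖e + V y‖ = ‖e‖ := by simp only [hVdef, add_sub_cancel]; rw [hw', R.norm_map, hM, heM]
    exact (inner_eq_of_norm_add_eq h).1
  have he0 : e 0 = 0 := by simp [he]
  have he1 : e 1 = 0 := by simp [he]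
  have he2 : e 2 ≠ 0 := by
    have : e 2 = ‖c‖ := by simp [he]
    rw [this]; exact hcn
  -- the deviation norms and the axial coordinate in the new frame
  have hnormV : ∀ y, ‖V y‖ = ‖w (R.symm y) - c‖ := fun y => by
    simp only [hVdef, hw']
    rw [← hRc, ← map_sub, R.norm_map]
  have hcoord : ∀ y, ⟪R.symm y, c⟫ / ‖c‖ = y 2 := fun y => by rw [hinner]; field_simp
  -- transfer of the slab integrability
  have hL2' : Integrable (fun y => {x : EuclideanSpace ℝ (Fin 3) | |x 2| ≤ T}.indicator (fun y => ‖V y‖ ^ 2) y) volume := by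
    have heq : (fun y => {x : EuclideanSpace ℝ (Fin 3) | |x 2| ≤ T}.indicator (fun y => ‖V y‖ ^ 2) y) =
        (fun x => {x : EuclideanSpace ℝ (Fin 3) | |⟪x, c⟫| / ‖c‖ ≤ T}.indicator (fun x => ‖w x - c‖ ^ 2) x) ∘ R.symm := by
      funext y
      simp only [Function.comp]
      have hmem : (y ∈ {x : EuclideanSpace ℝ (Fin 3) | |x 2| ≤ T}) ↔
          (R.symm y ∈ {x : EuclideanSpace ℝ (Fin 3) | |⟪x, c⟫| / ‖c‖ ≤ T}) := by
        simp only [mem_setOf_eq]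
        rw [hinner, abs_mul, abs_of_pos (norm_pos_iff.2 hc), mul_div_cancel_left₀ _ hcn]
      by_cases hy : y ∈ {x : EuclideanSpace ℝ (Fin 3) | |x 2| ≤ T}
      · rw [indicator_of_mem hy, indicator_of_mem (hmem.1 hy), hnormV]
      · rw [indicator_of_notMem hy, indicator_of_notMem (fun h => hy (hmem.2 h))]
    rw [heq]
    exact (R.symm.measurePreserving.integrable_comp hL2.aestronglyMeasurable).2 hL2
  -- transfer of the window integrals
  have hwin : ∀ r : ℝ, (∫ x, deriv Real.smoothTransition (⟪x, c⟫ / ‖c‖ - r) * ‖w x - c‖ ^ 2) =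
      ∫ y, deriv Real.smoothTransition (y 2 - r) * ‖V y‖ ^ 2 := by
    intro r
    rw [← R.symm.measurePreserving.integral_comp R.symm.toHomeomorph.measurableEmbedding
      (fun x => deriv Real.smoothTransition (⟪x, c⟫ / ‖c‖ - r) * ‖w x - c‖ ^ 2)]
    congr 1
    funext y
    rw [hcoord, hnormV]
  rw [hwin s, hwin t]
  exact integral_deriv_smoothTransition_mul_sq_eq hV hVdiv hVc he0 he1 he2 hs ht hL2'

/-- **Vanishing-window Liouville, general direction.**  A `C¹` divergence-free field with `‖w‖ ≡ M = ‖c‖`, `c ≠ 0`,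
`‖w − c‖² ∈ L¹` of every slab `{|⟪x, c⟫| ≤ T‖c‖}` and arbitrarily small window energies along `c` is the constant `c`.
Contrapositive — **THE JET THEOREM** for the K1b residue object: unless some slab orthogonal to the far field carries infinite
excess energy, EVERY unit window of planes orthogonal to `c` carries the same excess energy `E₀ > 0`. [folklore] -/
theorem eq_farField_of_constSpeed_of_smallWindow (hw : ContDiff ℝ 1 w) (hdiv : VectorCalculus.IsDivFree w)
    (hM : ∀ x, ‖w x‖ = M) (hcM : ‖c‖ = M) (hc : c ≠ 0)
    (hslab : ∀ T : ℝ, 0 < T →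
      Integrable (fun x => {x : EuclideanSpace ℝ (Fin 3) | |⟪x, c⟫| / ‖c‖ ≤ T}.indicator (fun x => ‖w x - c‖ ^ 2) x) volume)
    (hsmall : ∀ ε : ℝ, 0 < ε → ∃ s : ℝ, (∫ x, deriv Real.smoothTransition (⟪x, c⟫ / ‖c‖ - s) * ‖w x - c‖ ^ 2) < ε) :
    ∀ x, w x = c := by
  obtain ⟨R, hRc, hinner, -⟩ := exists_isometry_to_axis hc
  set e : EuclideanSpace ℝ (Fin 3) := ‖c‖ • EuclideanSpace.single (2 : Fin 3) (1 : ℝ) with he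
  have hcn : ‖c‖ ≠ 0 := norm_ne_zero_iff.2 hc
  set w' : EuclideanSpace ℝ (Fin 3) → EuclideanSpace ℝ (Fin 3) := fun y => R (w (R.symm y)) with hw'
  have hw'1 : ContDiff ℝ 1 w' := R.toContinuousLinearEquiv.contDiff.comp (hw.comp R.symm.toContinuousLinearEquiv.contDiff)
  have hdiv' : VectorCalculus.IsDivFree w' := hdiv.conj_linearIsometryEquiv R
  have hM' : ∀ y, ‖w' y‖ = M := fun y => by rw [hw', R.norm_map, hM]
  have heM : ‖e‖ = M := by
    rw [he, norm_smul, Real.norm_eq_abs, abs_of_nonneg (norm_nonneg _), PiLp.norm_single, norm_one, mul_one, hcM]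
  have he0 : e 0 = 0 := by simp [he]
  have he1 : e 1 = 0 := by simp [he]
  have he2 : e 2 ≠ 0 := by
    have : e 2 = ‖c‖ := by simp [he]
    rw [this]; exact hcn
  have hnormV : ∀ y, ‖w' y - e‖ = ‖w (R.symm y) - c‖ := fun y => by
    simp only [hw']
    rw [← hRc, ← map_sub, R.norm_map]
  have hcoord : ∀ y, ⟪R.symm y, c⟫ / ‖c‖ = y 2 := fun y => by rw [hinner]; field_simp
  have hslab' : ∀ T : ℝ, 0 < T →
      Integrable (fun y => {x : EuclideanSpace ℝ (Fin 3) | |x 2| ≤ T}.indicator (fun y => ‖w' y - e‖ ^ 2) y) volume := by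
    intro T hT
    have hL2 := hslab T hT
    have heq : (fun y => {x : EuclideanSpace ℝ (Fin 3) | |x 2| ≤ T}.indicator (fun y => ‖w' y - e‖ ^ 2) y) =
        (fun x => {x : EuclideanSpace ℝ (Fin 3) | |⟪x, c⟫| / ‖c‖ ≤ T}.indicator (fun x => ‖w x - c‖ ^ 2) x) ∘ R.symm := by
      funext y
      simp only [Function.comp]
      have hmem : (y ∈ {x : EuclideanSpace ℝ (Fin 3) | |x 2| ≤ T}) ↔
          (R.symm y ∈ {x : EuclideanSpace ℝ (Fin 3) | |⟪x, c⟫| / ‖c‖ ≤ T}) := by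
        simp only [mem_setOf_eq]
        rw [hinner, abs_mul, abs_of_pos (norm_pos_iff.2 hc), mul_div_cancel_left₀ _ hcn]
      by_cases hy : y ∈ {x : EuclideanSpace ℝ (Fin 3) | |x 2| ≤ T}
      · rw [indicator_of_mem hy, indicator_of_mem (hmem.1 hy), hnormV]
      · rw [indicator_of_notMem hy, indicator_of_notMem (fun h => hy (hmem.2 h))]
    rw [heq]
    exact (R.symm.measurePreserving.integrable_comp hL2.aestronglyMeasurable).2 hL2
  have hwin : ∀ r : ℝ, (∫ x, deriv Real.smoothTransition (⟪x, c⟫ / ‖c‖ - r) * ‖w x - c‖ ^ 2) =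
      ∫ y, deriv Real.smoothTransition (y 2 - r) * ‖w' y - e‖ ^ 2 := by
    intro r
    rw [← R.symm.measurePreserving.integral_comp R.symm.toHomeomorph.measurableEmbedding
      (fun x => deriv Real.smoothTransition (⟪x, c⟫ / ‖c‖ - r) * ‖w x - c‖ ^ 2)]
    congr 1
    funext y
    rw [hcoord, hnormV]
  have hsmall' : ∀ ε : ℝ, 0 < ε → ∃ s : ℝ, (∫ y, deriv Real.smoothTransition (y 2 - s) * ‖w' y - e‖ ^ 2) < ε := by
    intro ε hε
    obtain ⟨s, hs⟩ := hsmall ε hε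
    exact ⟨s, by rw [← hwin]; exact hs⟩
  have h := eq_farField_of_constSpeed_of_smallWindow_axial hw'1 hdiv' hM' heM he0 he1 he2 hslab' hsmall'
  intro x
  have hx := h (R x)
  simp only [hw', LinearIsometryEquiv.symm_apply_apply] at hx
  rw [← hRc] at hx
  exact R.injective hx

/-- **Horizontal-decay Liouville, general direction.**  A `C¹` divergence-free field with `‖w‖ ≡ M = ‖c‖`, `c ≠ 0`, `w → c`
at infinity and `‖w x − c‖ ≤ C₀ (1 + dist(x, ℝc))^{-a}` for some `a > 1` is the constant `c`
(`dist(x, ℝc) = ‖x − (⟪x,c⟫/‖c‖²)c‖`).  Strictly contains g4's decay-gap Liouville. [folklore] -/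
theorem eq_farField_of_constSpeed_of_horizontalDecay (hw : ContDiff ℝ 1 w) (hdiv : VectorCalculus.IsDivFree w)
    (hM : ∀ x, ‖w x‖ = M) (hcM : ‖c‖ = M) (hc : c ≠ 0) {a C₀ : ℝ} (ha : 1 < a)
    (hdec : ∀ x, ‖w x - c‖ ≤ C₀ * (1 + ‖x - (⟪x, c⟫ / ‖c‖ ^ 2) • c‖) ^ (-a))
    (hfar : Tendsto (fun x => w x - c) (cocompact (EuclideanSpace ℝ (Fin 3))) (𝓝 0)) : ∀ x, w x = c := by
  obtain ⟨R, hRc, hinner, hdist⟩ := exists_isometry_to_axis hc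
  set e : EuclideanSpace ℝ (Fin 3) := ‖c‖ • EuclideanSpace.single (2 : Fin 3) (1 : ℝ) with he
  have hcn : ‖c‖ ≠ 0 := norm_ne_zero_iff.2 hc
  set w' : EuclideanSpace ℝ (Fin 3) → EuclideanSpace ℝ (Fin 3) := fun y => R (w (R.symm y)) with hw'
  have hw'1 : ContDiff ℝ 1 w' := R.toContinuousLinearEquiv.contDiff.comp (hw.comp R.symm.toContinuousLinearEquiv.contDiff)
  have hdiv' : VectorCalculus.IsDivFree w' := hdiv.conj_linearIsometryEquiv R
  have hM' : ∀ y, ‖w' y‖ = M := fun y => by rw [hw', R.norm_map, hM]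
  have heM : ‖e‖ = M := by
    rw [he, norm_smul, Real.norm_eq_abs, abs_of_nonneg (norm_nonneg _), PiLp.norm_single, norm_one, mul_one, hcM]
  have he0 : e 0 = 0 := by simp [he]
  have he1 : e 1 = 0 := by simp [he]
  have he2 : e 2 ≠ 0 := by
    have : e 2 = ‖c‖ := by simp [he]
    rw [this]; exact hcn
  have hVeq : ∀ y, w' y - e = R (w (R.symm y) - c) := fun y => by
    simp only [hw']
    rw [map_sub, hRc]
  have hdec' : ∀ y, ‖w' y - e‖ ≤ C₀ * (1 + cylRadius y) ^ (-a) := fun y => by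
    rw [hVeq, R.norm_map, ← hdist y]
    exact hdec (R.symm y)
  have hfar' : Tendsto (fun y => w' y - e) (cocompact (EuclideanSpace ℝ (Fin 3))) (𝓝 0) := by
    have h1 : Tendsto (fun y => w (R.symm y) - c) (cocompact (EuclideanSpace ℝ (Fin 3))) (𝓝 0) :=
      hfar.comp R.symm.toHomeomorph.isClosedEmbedding.tendsto_cocompact
    have h2 := (R.continuous.tendsto 0).comp h1
    rw [map_zero] at h2
    refine h2.congr fun y => ?_
    simp only [Function.comp, hVeq]
  have h := eq_farField_of_constSpeed_of_horizontalDecay_axial hw'1 hdiv' hM' heM he0 he1 he2 ha hdec' hfar'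
  intro x
  have hx := h (R x)
  simp only [hw', LinearIsometryEquiv.symm_apply_apply] at hx
  rw [← hRc] at hx
  exact R.injective hx

/-! ## K1b ⟸ «no flat slab and no jet» -/

/-- **K1b ⟸ NO JET (the residue object is a bi-infinite jet or has a flat slab).**  If every constant-speed analytic extended
extremiser `w` (structural hypotheses of the stub, `‖w‖ ≡ M`, `|S| = κ⋆M√Z√W > 0`) with far field `c` (`‖c‖ = M`, `w → c`) is
NEITHER «flat» (some slab `{|⟪x,c⟫| ≤ T‖c‖}` with `∫‖w − c‖² = ∞`) NOR «a jet» (all slabs square integrable and a constant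
window energy `E₀ > 0` along `c`), then K1b (`stub_noAnalyticExtremal`, verbatim) holds.  Both alternatives are otherwise
FORCED by the energy-flux invariance (this file): so the typed K1b target after g5 is «exclude the flat slab and the
bi-infinite jet». [folklore] -/
theorem stub_noAnalyticExtremal_of_noJetObject
    (hres : ∀ (w : EuclideanSpace ℝ (Fin 3) → EuclideanSpace ℝ (Fin 3)) (c : EuclideanSpace ℝ (Fin 3)) (M : ℝ),
      AnalyticOnNhd ℝ w Set.univ → ContDiff ℝ (⊤ : ℕ∞) w → Literature.Analysis.FluidPDE.VectorCalculus.IsDivFree w →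
      (∃ B : ℝ, ∀ x, ‖fderiv ℝ w x‖ ≤ B) → (∫⁻ x, ‖iteratedFDeriv ℝ 1 w x‖ₑ ^ 2 < ⊤) → (∫⁻ x, ‖iteratedFDeriv ℝ 2 w x‖ₑ ^ 2 < ⊤) →
      (∀ x, ‖w x‖ = M) → ‖c‖ = M → Filter.Tendsto (fun x => w x - c) (Filter.cocompact (EuclideanSpace ℝ (Fin 3))) (nhds 0) →
      0 < M * Real.sqrt (∫ x, ‖Literature.Analysis.FluidPDE.curl w x‖ ^ 2) * Real.sqrt (∫ x, Literature.Analysis.FluidPDE.frobeniusNormSq (fderiv ℝ (Literature.Analysis.FluidPDE.curl w) x)) →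
      (sInf {κ : ℝ | (∀ (v : EuclideanSpace ℝ (Fin 3) → EuclideanSpace ℝ (Fin 3)) (M B : ℝ), ContDiff ℝ (⊤ : ℕ∞) v → Literature.Analysis.FluidPDE.VectorCalculus.IsDivFree v → (∀ x, ‖v x‖ ≤ M) → (∀ x, ‖fderiv ℝ v x‖ ≤ B) → (∫⁻ x, ‖iteratedFDeriv ℝ 0 v x‖ₑ ^ 2 < ⊤) → (∫⁻ x, ‖iteratedFDeriv ℝ 1 v x‖ₑ ^ 2 < ⊤) → (∫⁻ x, ‖iteratedFDeriv ℝ 2 v x‖ₑ ^ 2 < ⊤) → |∫ x, ⟪Literature.Analysis.FluidPDE.curl v x, fderiv ℝ v x (Literature.Analysis.FluidPDE.curl v x)⟫_ℝ| ≤ κ * M * Real.sqrt (∫ x, ‖Literature.Analysis.FluidPDE.curl v x‖ ^ 2) * Real.sqrt (∫ x, Literature.Analysis.FluidPDE.frobeniusNormSq (fderiv ℝ (Literature.Analysis.FluidPDE.curl v) x)))}) * M * Real.sqrt (∫ x, ‖Literature.Analysis.FluidPDE.curl w x‖ ^ 2) * Real.sqrt (∫ x, Literature.Analysis.FluidPDE.frobeniusNormSq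 (fderiv ℝ (Literature.Analysis.FluidPDE.curl w) x)) = |∫ x, ⟪Literature.Analysis.FluidPDE.curl w x, fderiv ℝ w x (Literature.Analysis.FluidPDE.curl w x)⟫_ℝ| →
      ¬ ((∃ T : ℝ, 0 < T ∧ ¬ Integrable (fun x => {x : EuclideanSpace ℝ (Fin 3) | |⟪x, c⟫_ℝ| / ‖c‖ ≤ T}.indicator (fun x => ‖w x - c‖ ^ 2) x) volume) ∨
         ((∀ T : ℝ, 0 < T → Integrable (fun x => {x : EuclideanSpace ℝ (Fin 3) | |⟪x, c⟫_ℝ| / ‖c‖ ≤ T}.indicator (fun x => ‖w x - c‖ ^ 2) x) volume) ∧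
           ∃ E₀ : ℝ, 0 < E₀ ∧ ∀ s : ℝ, (∫ x, deriv Real.smoothTransition (⟪x, c⟫_ℝ / ‖c‖ - s) * ‖w x - c‖ ^ 2) = E₀))) :
    ¬ ∃ (w : EuclideanSpace ℝ (Fin 3) → EuclideanSpace ℝ (Fin 3)), AnalyticOnNhd ℝ w Set.univ ∧ (ContDiff ℝ (⊤ : ℕ∞) w ∧ Literature.Analysis.FluidPDE.VectorCalculus.IsDivFree w ∧ (∃ B : ℝ, ∀ x, ‖fderiv ℝ w x‖ ≤ B) ∧ (∫⁻ x, ‖iteratedFDeriv ℝ 1 w x‖ₑ ^ 2 < ⊤) ∧ (∫⁻ x, ‖iteratedFDeriv ℝ 2 w x‖ₑ ^ 2 < ⊤) ∧ ∃ M : ℝ, (∀ x, ‖w x‖ ≤ M) ∧ 0 < M * Real.sqrt (∫ x, ‖Literature.Analysis.FluidPDE.curl w x‖ ^ 2) * Real.sqrt (∫ x, Literature.Analysis.FluidPDE.frobeniusNormSq (fderiv ℝ (Literature.Analysis.FluidPDE.curl w) x)) ∧ (sInf {κ : ℝ | (∀ (v : EuclideanSpace ℝ (Fin 3) → EuclideanSpace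 ℝ (Fin 3)) (M B : ℝ), ContDiff ℝ (⊤ : ℕ∞) v → Literature.Analysis.FluidPDE.VectorCalculus.IsDivFree v → (∀ x, ‖v x‖ ≤ M) → (∀ x, ‖fderiv ℝ v x‖ ≤ B) → (∫⁻ x, ‖iteratedFDeriv ℝ 0 v x‖ₑ ^ 2 < ⊤) → (∫⁻ x, ‖iteratedFDeriv ℝ 1 v x‖ₑ ^ 2 < ⊤) → (∫⁻ x, ‖iteratedFDeriv ℝ 2 v x‖ₑ ^ 2 < ⊤) → |∫ x, ⟪Literature.Analysis.FluidPDE.curl v x, fderiv ℝ v x (Literature.Analysis.FluidPDE.curl v x)⟫_ℝ| ≤ κ * M * Real.sqrt (∫ x, ‖Literature.Analysis.FluidPDE.curl v x‖ ^ 2) * Real.sqrt (∫ x, Literature.Analysis.FluidPDE.frobeniusNormSq (fderiv ℝ (Literature.Analysis.FluidPDE.curl v) x)))}) * M * Real.sqrt (∫ x, ‖Literature.Analysis.FluidPDE.curl w x‖ ^ 2) * Real.sqrt (∫ x, Literature.Analysis.FluidPDE.frobeniusNormSq (fderiv ℝ (Literature.Analysis.FluidPDE.curl w) x)) ≤ |∫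 x, ⟪Literature.Analysis.FluidPDE.curl w x, fderiv ℝ w x (Literature.Analysis.FluidPDE.curl w x)⟫_ℝ|) := by
  refine stub_noAnalyticExtremal_iff_noConstantSpeedExtremiser.2 ?_
  rintro ⟨w, han, hcd, hdiv, ⟨B, hB⟩, h1, h2, M, hM, hpos, hge⟩
  have hle := extendedSharp w M B hcd hdiv (fun x => (hM x).le) hB h1 h2
  have heq := le_antisymm hge hle
  obtain ⟨c, hcM, hfar, -⟩ :=
    exists_inner_farField_nonpos_of_constSpeed_extremal hcd hdiv hM hB h1 h2 hpos heq.symm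
  have hnojet := hres w c M han hcd hdiv ⟨B, hB⟩ h1 h2 hM hcM hfar hpos heq
  -- `c ≠ 0`
  have hMpos : 0 < M := by
    have hM0 : 0 ≤ M := (norm_nonneg _).trans (hM 0).le
    rcases hM0.lt_or_eq with h | h
    · exact h
    · rw [← h, zero_mul, zero_mul] at hpos; exact absurd hpos (lt_irrefl 0)
  have hc : c ≠ 0 := by
    intro h0; rw [h0, norm_zero] at hcM; linarith
  have hw1 : ContDiff ℝ 1 w := contDiff_infty.1 hcd 1
  -- not flat: every slab is square integrable
  have hslab : ∀ T : ℝ, 0 < T →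
      Integrable (fun x => {x : EuclideanSpace ℝ (Fin 3) | |⟪x, c⟫| / ‖c‖ ≤ T}.indicator (fun x => ‖w x - c‖ ^ 2) x) volume := by
    intro T hT
    by_contra hnot
    exact hnojet (Or.inl ⟨T, hT, hnot⟩)
  -- the window energies are constant …
  have hconst : ∀ s : ℝ, (∫ x, deriv Real.smoothTransition (⟪x, c⟫ / ‖c‖ - s) * ‖w x - c‖ ^ 2) =
      ∫ x, deriv Real.smoothTransition (⟪x, c⟫ / ‖c‖ - 0) * ‖w x - c‖ ^ 2 := by
    intro s
    have hT : 0 < |s| + 1 + 1 := by positivity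
    exact integral_deriv_smoothTransition_axialCoord_mul_sq_eq hw1 hdiv hM hcM hc (T := |s| + 1 + 1)
      (by linarith) (by rw [abs_zero]; linarith [abs_nonneg s]) (hslab _ hT)
  set E₀ : ℝ := ∫ x, deriv Real.smoothTransition (⟪x, c⟫ / ‖c‖ - 0) * ‖w x - c‖ ^ 2 with hE₀
  -- … and not positive (no jet), hence zero
  have hE₀0 : 0 ≤ E₀ := integral_nonneg fun x => mul_nonneg (Real.smoothTransition.monotone.deriv_nonneg) (sq_nonneg _)
  have hE₀le : ¬ 0 < E₀ := fun hpos' => hnojet (Or.inr ⟨hslab, E₀, hpos', hconst⟩)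
  have hE₀eq : E₀ = 0 := le_antisymm (not_lt.1 hE₀le) hE₀0
  have hsmall : ∀ ε : ℝ, 0 < ε → ∃ s : ℝ, (∫ x, deriv Real.smoothTransition (⟪x, c⟫ / ‖c‖ - s) * ‖w x - c‖ ^ 2) < ε :=
    fun ε hε => ⟨0, by rw [← hE₀, hE₀eq]; exact hε⟩
  have hconstw := eq_farField_of_constSpeed_of_smallWindow hw1 hdiv hM hcM hc hslab hsmall
  have hw : w = fun _ => c := funext hconstw
  have hcurl : ∀ x, curl w x = 0 := fun x => by
    rw [hw, curl_eq_curlCLM, fderiv_const_apply, map_zero]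
  have hZ : (∫ x, ‖curl w x‖ ^ 2) = 0 := by simp [hcurl]
  rw [hZ, Real.sqrt_zero, mul_zero, zero_mul] at hpos
  exact lt_irrefl _ hpos

end ExtremiserLiouville

end Summit.NavierStokesRegularity.NavierStokesRegularity.Theorems

end
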